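import Mathlib
import HarnessLib
import Summits.KontsevichZagierPeriods.Zeta5Search.TwoTaleWhipple
import Summits.KontsevichZagierPeriods.Zeta5Search.TwoTaleR3GrowthEnclosure
import Summits.KontsevichZagierPeriods.Zeta5Search.TwoTaleP15GrowthEnclosure

/-!
# Two tales, both kernel rungs: the growth inputs reduced to `WhippleRemark5`

HONEST FRAMING: systematic search; no irrationality claim unless certified.  IMPLICATIONS ONLY — `Inclusion(A)`,
`Decay(A) c` (fam-denom) and `WhippleRemark5` (Whipple's transformation in Zudilin's Remark-5 form, a published
theorem typed but not proved in the tree, `TwoTaleWhipple`) remain named inputs; no measure of `ζ(2)` is certified.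

* `formQTZ_aTA_eq_qhatA` — the reindexing bridge at rung A: the Literature's `formQTZ` at the partner
  `aTA = (15n+2; 5n+1, 6n+1, 7n+1)`, `bTA = (7n+2; 3n+1, 11n+2, 12n+2)` IS fam-measure's one-signed sum `qhatA n`
  (global sign `(−1)^{23n+4}` against termwise sign `(−1)^{2k−3n−2}`: product `+1`);
* **`whippleA_of_remark5 : WhippleRemark5 → WhippleA`** (rung A needs nothing else: `formQA` is `formQZ` by
  definition), hence **`zetaTwo_exponent_le_of_remark5A : InclusionA → DecayA 13.229 → WhippleRemark5 →
  ExponentLE (zetaValue 2) 5.2053`** (and the loose `DecayA 13.2 → 5.233`);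
* at P15, with the identification `hB : ∀ n ≥ 1, formQ n = qP15 n` of fam-denom's directly typed coefficient with
  `formQZ (aP15 n) (bP15 n)` as an explicit hypothesis: `zetaTwo_exponent_le_of_remark5 : hB → Inclusion →
  Decay 29.10787 → WhippleRemark5 → ExponentLE (zetaValue 2) 5.0499 ∧ Zudilin2014.zetaTwo_irrationalityExponent_le`
  (robust `Decay 29.1 → 5.0521`).

So the growth side of BOTH rungs of fam-measure's kernel route hangs on ONE classical theorem stated once over the
Literature's closed forms (`TwoTaleWhipple.WhippleRemark5`), plus (at P15 only) a bookkeeping identity.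
Cell pub-zeta5, fam-measure (T3); `families/measure/FAMILY.md` §10.
-/

noncomputable section

namespace Summit.KontsevichZagierPeriods.Zeta5Search.TwoTaleWhipple

open Finset
open Literature.NumberTheory.Irrationality.Zudilin2014
open Summit.KontsevichZagierPeriods.Zeta5Search

/-! ### The reindexing bridge at rung A -/

/-- Termwise at rung A: `coefATZ (aTA n) (bTA n) k = (−1)^n · termA n k` on the window `k ≥ 7n+1`. -/
theorem coefATZ_aTA (n k : ℕ) (hk : 7 * n + 1 ≤ k) :
    coefATZ (aTA n) (bTA n) (k : ℤ) = (-1) ^ n * (TwoTaleR3Growth.termA n k : ℤ) := by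
  unfold coefATZ TwoTaleR3Growth.termA
  have h0 : (2 * (k : ℤ) - bTA n 0).toNat = 2 * k - (7 * n + 2) := by simp; omega
  have h1 : (aTA n 0 - bTA n 0).toNat = 8 * n := by simp; omega
  have h2 : ((k : ℤ) - bTA n 1).toNat = k - (3 * n + 1) := by simp; omega
  have h3 : (aTA n 1 - bTA n 1).toNat = 2 * n := by simp; omega
  have h4 : (bTA n 2 - aTA n 2 - 1).toNat = 5 * n := by simp; omega
  have h5 : ((k : ℤ) - aTA n 2).toNat = k - (6 * n + 1) := by simp; omega
  have h6 : (bTA n 3 - aTA n 3 - 1).toNat = 5 * n := by simp; omega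
  have h7 : ((k : ℤ) - aTA n 3).toNat = k - (7 * n + 1) := by simp; omega
  rw [h0, h1, h2, h3, h4, h5, h6, h7]
  split_ifs with hlt
  · simp only [aTA_zero] at hlt
    rw [Nat.choose_eq_zero_of_lt (by omega : 2 * k - (7 * n + 2) < 8 * n)]
    simp
  · simp only [aTA_zero, not_lt] at hlt
    have hex : 8 * n + 2 * n + (k - (6 * n + 1)) + (k - (7 * n + 1)) = n + 2 * (k - 2 * n - 1) := by omega
    rw [hex, pow_add, pow_mul, neg_one_sq, one_pow, mul_one]
    push_cast
    ring

/-- **Bridge at rung A**: `formQTZ (aTA n) (bTA n) = qhatA n` (all `n`). -/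
theorem formQTZ_aTA_eq_qhatA (n : ℕ) : formQTZ (aTA n) (bTA n) = (TwoTaleR3Growth.qhatA n : ℤ) := by
  unfold formQTZ TwoTaleR3Growth.qhatA
  rw [(rangeA_eq n).1, (rangeA_eq n).2]
  have hsign : (-1 : ℤ) ^ (bTA n 2 + bTA n 3).natAbs = (-1) ^ n := by
    have : (bTA n 2 + bTA n 3).natAbs = n + 2 * (11 * n + 2) := by simp; omega
    rw [this, pow_add, pow_mul]
    simp
  rw [hsign, show (7 * (n : ℤ) + 1 : ℤ) = ((7 * n + 1 : ℕ) : ℤ) by push_cast; ring,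
    show (11 * (n : ℤ) + 2 : ℤ) = ((11 * n + 2 : ℕ) : ℤ) by push_cast; ring, sum_Ico_natCast,
    ← Finset.sum_Ico_consecutive _ (show 7 * n + 1 ≤ 11 * n + 2 by omega)
      (show 11 * n + 2 ≤ 12 * n + 2 by omega)]
  have htail : ∑ k ∈ Ico (11 * n + 2) (12 * n + 2), TwoTaleR3Growth.termA n k = 0 := by
    refine Finset.sum_eq_zero fun k hk => ?_
    rw [Finset.mem_Ico] at hk
    unfold TwoTaleR3Growth.termA
    rw [Nat.choose_eq_zero_of_lt (by omega : 5 * n < k - (6 * n + 1))]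
    ring
  rw [htail, add_zero, Finset.mul_sum]
  push_cast
  refine Finset.sum_congr rfl fun k hk => ?_
  rw [coefATZ_aTA n k (by rw [Finset.mem_Ico] at hk; omega), ← mul_assoc, ← pow_add, ← two_mul, pow_mul]
  simp

/-- **`WhippleRemark5 → WhippleA`.** -/
theorem whippleA_of_remark5 (hW : WhippleRemark5) : TwoTaleR3Growth.WhippleA := by
  intro n hn
  rw [formQA_eq_neg_formQTZ hW hn, formQTZ_aTA_eq_qhatA]

/-! ### Packaged exponents from the single named input -/

section Packaged

open Literature.NumberTheory.Irrationality
open Literature.NumberTheory.Transcendental (zetaValue)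
open Summit.KontsevichZagierPeriods.Zeta5Search.Denom.TwoTaleR3Forms (InclusionA DecayA)
open Summit.KontsevichZagierPeriods.Zeta5Search.Denom.TwoTaleP15Forms (Inclusion Decay)

/-- **Rung A from the single named input:** `InclusionA → DecayA 13.229 → WhippleRemark5 → μ(ζ(2)) ≤ 5.2053`
(printed `5.20514736…`; the rung whose `DecayA` needs no missing-zero input). -/
theorem zetaTwo_exponent_le_of_remark5A (hI : InclusionA) (hD : DecayA 13.229) (hW : WhippleRemark5) :
    ExponentLE (zetaValue 2) 5.2053 :=
  TwoTaleR3Growth.zetaTwo_exponent_le_of_whippleA₃ hI hD (whippleA_of_remark5 hW)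

/-- Rung A, loose decay constant: `InclusionA → DecayA 13.2 → WhippleRemark5 → μ(ζ(2)) ≤ 5.233`. -/
theorem zetaTwo_exponent_le_looseA_of_remark5 (hI : InclusionA) (hD : DecayA 13.2) (hW : WhippleRemark5) :
    ExponentLE (zetaValue 2) 5.233 :=
  TwoTaleR3Growth.zetaTwo_exponent_le_looseA_of_whipple₃ hI hD (whippleA_of_remark5 hW)

/-- **P15 from the single named input** (plus the bookkeeping identity `formQ n = qP15 n`):
`Inclusion → Decay 29.10787 → WhippleRemark5 → μ(ζ(2)) ≤ 5.0499 ∧ record`. -/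
theorem zetaTwo_exponent_le_of_remark5 (hB : ∀ n : ℕ, 1 ≤ n → Denom.TwoTaleP15Forms.formQ n = TwoTaleP15.qP15 n)
    (hI : Inclusion) (hD : Decay 29.10787) (hW : WhippleRemark5) :
    ExponentLE (zetaValue 2) 5.0499 ∧ Zudilin2014.zetaTwo_irrationalityExponent_le :=
  TwoTaleP15Growth.zetaTwo_exponent_le_of_whipple₃ hI hD (whippleP15_of_remark5 hB hW)

/-- P15, robust decay constant: `Inclusion → Decay 29.1 → WhippleRemark5 → μ(ζ(2)) ≤ 5.0521 ∧ record`. -/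
theorem zetaTwo_exponent_le_of_remark5_robust (hB : ∀ n : ℕ, 1 ≤ n → Denom.TwoTaleP15Forms.formQ n = TwoTaleP15.qP15 n)
    (hI : Inclusion) (hD : Decay 29.1) (hW : WhippleRemark5) :
    ExponentLE (zetaValue 2) 5.0521 ∧ Zudilin2014.zetaTwo_irrationalityExponent_le :=
  TwoTaleP15Growth.zetaTwo_exponent_le_of_whipple₃_robust hI hD (whippleP15_of_remark5 hB hW)

end Packaged

end Summit.KontsevichZagierPeriods.Zeta5Search.TwoTaleWhipple

end
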